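import Summits.HubbardSuperconductivity.HubbardSuperconductivity.Theorems.AnisotropyChordTransferFibre3Hole2Green

/-!
# Route `AnisotropyChord` / H0 rotor rung: HOLE₂ per-`L` certificates — SOUNDNESS III: the positivity test and the domination of the Green matrix

For a pair `(0, (s₁,s₂))` of the kernel checker `…Fibre3Hole2Check`:
* `psdCheck_sound`: the exact Schur-complement elimination `psdCheck n M = true` on a symmetric rational matrix gives a non-negative
  quadratic form `qf n M x ≥ 0` for every real `x` (zero pivots with vanishing row/column allowed);
* `quad_le_of_near`: an entrywise enclosure `|G − m| ≤ r` gives `yᵀGy ≤ yᵀmy + Σ_p y_p² Σ_q (r_pq + r_qp)/2`;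
* the pair data read in `ℝ` (`ptT`, `GI`, `EZ`, `ER = eMat/D`, `XR = X2/2D`, `GR = Re G̃_{g_L}(pt p − pt q)`, `SR`), `mem_GR` (each true
  Green matrix entry lies in its fixed-point interval, from `…Fibre3Hole2Green.mem_greenW`) and ★ `quad_GR_le_XR`: `yᵀ G y ≤ yᵀ X_r y`.
The aggregation and the real certificate inequality follow in `…Fibre3Hole2Agg`; the passage to `TwoHoleGap` in `…Fibre3Hole2Cert`.
Prover seat `hubbard-h0-rotor-p3` g3; helper for stmt-HubbardSuperconductivity-19089 (`--supports`, helper class).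
WHAT THIS IS NOT: nothing here proves superconductivity in the Hubbard model (rotor TARGET as worded stays FALSE, g15 verdict);
soundness lemmas for the per-`L` HOLE₂ certificates of ONE conditional reduction (rung 19089). Mathlib + tree imports only; no sorry.
-/

set_option linter.dupNamespace false
set_option autoImplicit false

namespace Summit.HubbardSuperconductivity.HubbardSuperconductivity.Theorems.AnisotropyChord.Transfer.Fibre3

namespace Hole2

open scoped BigOperators
open Finset

/-! ## The quadratic form of an `ℕ`-indexed matrix and the soundness of `psdCheck` -/

/-- `qf n M x = Σ_{i,j<n} x_i x_j M_ij` (read in `ℝ`). [folklore] -/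
noncomputable def qf (n : ℕ) (M : ℕ → ℕ → ℚ) (x : ℕ → ℝ) : ℝ :=
  ∑ i ∈ range n, ∑ j ∈ range n, x i * x j * ((M i j : ℚ) : ℝ)

/-- `tab n M` agrees with `M` inside the range. [folklore] -/
theorem tab_eq {α : Type} [Zero α] (n : ℕ) (M : ℕ → ℕ → α) {i j : ℕ} (hi : i < n) (hj : j < n) :
    tab n M i j = M i j := by
  unfold tab
  rw [getD_map_range _ _ hi, getD_map_range _ _ hj]

/-- tabulation does not change the quadratic form. [folklore] -/
theorem qf_tab (n : ℕ) (M : ℕ → ℕ → ℚ) (x : ℕ → ℝ) : qf n (tab n M) x = qf n M x := by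
  unfold qf
  refine Finset.sum_congr rfl fun i hi => Finset.sum_congr rfl fun j hj => ?_
  rw [tab_eq n M (mem_range.mp hi) (mem_range.mp hj)]

/-- peeling index `0` off the quadratic form. [folklore] -/
theorem qf_succ (n : ℕ) (M : ℕ → ℕ → ℚ) (x : ℕ → ℝ) :
    qf (n + 1) M x = x 0 * x 0 * ((M 0 0 : ℚ) : ℝ)
      + (∑ j ∈ range n, x 0 * x (j + 1) * ((M 0 (j + 1) : ℚ) : ℝ))
      + (∑ i ∈ range n, x (i + 1) * x 0 * ((M (i + 1) 0 : ℚ) : ℝ))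
      + qf n (minor0 M) (fun i => x (i + 1)) := by
  unfold qf minor0
  simp only [Finset.sum_range_succ', Finset.sum_add_distrib]
  ring

/-- the Schur complement's quadratic form: `qf (schur M) x' = qf (minor M) x' − (Σ_i x'_i M_{i+1,0})(Σ_j M_{0,j+1} x'_j)/M₀₀`. [folklore] -/
theorem qf_schur (n : ℕ) (M : ℕ → ℕ → ℚ) (x : ℕ → ℝ) :
    qf n (schur M) (fun i => x (i + 1))
      = qf n (minor0 M) (fun i => x (i + 1))
        - (∑ i ∈ range n, x (i + 1) * ((M (i + 1) 0 : ℚ) : ℝ)) * (∑ j ∈ range n, x (j + 1) * ((M 0 (j + 1) : ℚ) : ℝ))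
            / ((M 0 0 : ℚ) : ℝ) := by
  unfold qf schur minor0
  push_cast
  rw [Finset.sum_mul_sum, Finset.sum_div, ← Finset.sum_sub_distrib]
  refine Finset.sum_congr rfl fun i _ => ?_
  rw [Finset.sum_div, ← Finset.sum_sub_distrib]
  refine Finset.sum_congr rfl fun j _ => ?_
  ring

/-- ★ SOUNDNESS OF THE POSITIVITY TEST: a symmetric (inside the range) rational matrix passing `psdCheck n` has a non-negative
quadratic form on the first `n` coordinates. [folklore] -/
theorem psdCheck_sound : ∀ (n : ℕ) (M : ℕ → ℕ → ℚ), (∀ i j, i < n → j < n → M i j = M j i) →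
    psdCheck n M = true → ∀ x : ℕ → ℝ, 0 ≤ qf n M x
  | 0, M, _, _, x => by simp [qf]
  | n + 1, M, hsym, h, x => by
    unfold psdCheck at h
    rw [qf_succ]
    have hcross : (∑ i ∈ range n, x (i + 1) * x 0 * ((M (i + 1) 0 : ℚ) : ℝ))
        = ∑ j ∈ range n, x 0 * x (j + 1) * ((M 0 (j + 1) : ℚ) : ℝ) := by
      refine Finset.sum_congr rfl fun i hi => ?_
      rw [hsym (i + 1) 0 (by have := mem_range.mp hi; omega) (by omega)]; ring
    by_cases hpos : 0 < M 0 0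
    · rw [if_pos hpos] at h
      have hsym' : ∀ i j, i < n → j < n → tab n (schur M) i j = tab n (schur M) j i := by
        intro i j hi hj
        rw [tab_eq n _ hi hj, tab_eq n _ hj hi]
        unfold schur
        rw [hsym (i + 1) (j + 1) (by omega) (by omega), hsym (i + 1) 0 (by omega) (by omega),
          hsym 0 (j + 1) (by omega) (by omega)]
        ring
      have ih := psdCheck_sound n (tab n (schur M)) hsym' h (fun i => x (i + 1))
      rw [qf_tab, qf_schur] at ih
      set a : ℝ := ((M 0 0 : ℚ) : ℝ) with ha
      set b : ℝ := ∑ j ∈ range n, x (j + 1) * ((M 0 (j + 1) : ℚ) : ℝ) with hb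
      set Q : ℝ := qf n (minor0 M) (fun i => x (i + 1)) with hQ
      have hapos : 0 < a := by rw [ha]; exact_mod_cast hpos
      have hb1 : (∑ j ∈ range n, x 0 * x (j + 1) * ((M 0 (j + 1) : ℚ) : ℝ)) = x 0 * b := by
        rw [hb, Finset.mul_sum]
        exact Finset.sum_congr rfl fun j _ => by ring
      have hb2 : (∑ i ∈ range n, x (i + 1) * ((M (i + 1) 0 : ℚ) : ℝ)) = b := by
        rw [hb]
        refine Finset.sum_congr rfl fun i hi => ?_
        rw [hsym (i + 1) 0 (by have := mem_range.mp hi; omega) (by omega)]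
      rw [hcross, hb1]
      rw [hb2] at ih
      -- `a x₀² + 2 x₀ b + Q = a (x₀ + b/a)² + (Q − b²/a)`
      have key : x 0 * x 0 * a + x 0 * b + x 0 * b + Q = a * (x 0 + b / a) ^ 2 + (Q - b * b / a) := by
        field_simp
        ring
      rw [key]
      have : 0 ≤ a * (x 0 + b / a) ^ 2 := by positivity
      linarith
    · rw [if_neg hpos] at h
      by_cases hz : M 0 0 = 0
      · rw [if_pos hz, Bool.and_eq_true] at h
        obtain ⟨hrow, hrec⟩ := h
        rw [List.all_eq_true] at hrow
        have hrow' : ∀ j, j < n + 1 → M 0 j = 0 ∧ M j 0 = 0 := by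
          intro j hj
          have := hrow j (List.mem_range.mpr hj)
          rw [Bool.and_eq_true, beq_iff_eq, beq_iff_eq] at this
          exact this
        have hsym' : ∀ i j, i < n → j < n → tab n (minor0 M) i j = tab n (minor0 M) j i := by
          intro i j hi hj
          rw [tab_eq n _ hi hj, tab_eq n _ hj hi]
          unfold minor0
          exact hsym (i + 1) (j + 1) (by omega) (by omega)
        have ih := psdCheck_sound n (tab n (minor0 M)) hsym' hrec (fun i => x (i + 1))
        rw [qf_tab] at ih
        have h0 : ((M 0 0 : ℚ) : ℝ) = 0 := by rw [hz]; push_cast; rfl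
        have h1 : (∑ j ∈ range n, x 0 * x (j + 1) * ((M 0 (j + 1) : ℚ) : ℝ)) = 0 := by
          refine Finset.sum_eq_zero fun j hj => ?_
          rw [(hrow' (j + 1) (by have := mem_range.mp hj; omega)).1]; push_cast; ring
        rw [hcross, h1, h0]
        linarith
      · rw [if_neg hz] at h
        exact absurd h Bool.false_ne_true

/-! ## Domination of the true Green matrix by `X2/(2D)` -/

/-- ★ entrywise enclosure ⇒ quadratic-form domination: if `|G_pq − m_pq| ≤ r_pq` on the range then
`Σ y_p y_q G_pq ≤ Σ y_p y_q m_pq + Σ_p y_p² · Σ_q (r_pq + r_qp)/2`. [folklore] -/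
theorem quad_le_of_near (n : ℕ) (G m r : ℕ → ℕ → ℝ) (y : ℕ → ℝ)
    (h : ∀ p q, p < n → q < n → |G p q - m p q| ≤ r p q) :
    (∑ p ∈ range n, ∑ q ∈ range n, y p * G p q * y q)
      ≤ (∑ p ∈ range n, ∑ q ∈ range n, y p * m p q * y q)
        + ∑ p ∈ range n, y p ^ 2 * ∑ q ∈ range n, (r p q + r q p) / 2 := by
  -- termwise: `y_p (G − m)_pq y_q ≤ (y_p² + y_q²)/2 · r_pq`
  have hterm : ∀ p ∈ range n, ∀ q ∈ range n,
      y p * G p q * y q ≤ y p * m p q * y q + (y p ^ 2 + y q ^ 2) / 2 * r p q := by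
    intro p hp q hq
    have h1 := h p q (mem_range.mp hp) (mem_range.mp hq)
    have hr : 0 ≤ r p q := (abs_nonneg _).trans h1
    have h2 : y p * (G p q - m p q) * y q ≤ |y p * y q| * r p q := by
      have : y p * (G p q - m p q) * y q = (y p * y q) * (G p q - m p q) := by ring
      rw [this]
      calc (y p * y q) * (G p q - m p q) ≤ |(y p * y q) * (G p q - m p q)| := le_abs_self _
        _ = |y p * y q| * |G p q - m p q| := abs_mul _ _
        _ ≤ |y p * y q| * r p q := mul_le_mul_of_nonneg_left h1 (abs_nonneg _)
    have hsq : |y p * y q| ≤ (y p ^ 2 + y q ^ 2) / 2 := by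
      rw [abs_mul]
      nlinarith [sq_nonneg (|y p| - |y q|), sq_abs (y p), sq_abs (y q), abs_nonneg (y p), abs_nonneg (y q)]
    have h3 : |y p * y q| * r p q ≤ (y p ^ 2 + y q ^ 2) / 2 * r p q := mul_le_mul_of_nonneg_right hsq hr
    nlinarith
  have hsum := Finset.sum_le_sum fun p hp => Finset.sum_le_sum fun q hq => hterm p hp q hq
  refine hsum.trans (le_of_eq ?_)
  simp only [Finset.sum_add_distrib]
  congr 1
  -- `Σ_pq (y_p² + y_q²)/2 r_pq = Σ_p y_p² Σ_q (r_pq + r_qp)/2`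
  have e1 : ∑ p ∈ range n, ∑ q ∈ range n, (y p ^ 2 + y q ^ 2) / 2 * r p q
      = (∑ p ∈ range n, ∑ q ∈ range n, y p ^ 2 / 2 * r p q) + ∑ p ∈ range n, ∑ q ∈ range n, y q ^ 2 / 2 * r p q := by
    rw [← Finset.sum_add_distrib]
    refine Finset.sum_congr rfl fun p _ => ?_
    rw [← Finset.sum_add_distrib]
    exact Finset.sum_congr rfl fun q _ => by ring
  rw [e1, Finset.sum_comm (f := fun p q => y q ^ 2 / 2 * r p q), ← Finset.sum_add_distrib]
  refine Finset.sum_congr rfl fun p _ => ?_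
  rw [Finset.mul_sum, ← Finset.sum_add_distrib]
  exact Finset.sum_congr rfl fun q _ => by ring

/-- from an enclosure: `|x·D − mid I| ≤ rad I`. [folklore] -/
theorem abs_sub_mid_le {x : ℝ} {I : Iv} (hx : mem x I) :
    |x * ((D : ℤ) : ℝ) - ((mid I : ℤ) : ℝ)| ≤ ((rad I : ℤ) : ℝ) := by
  unfold mem at hx
  obtain ⟨h1, h2⟩ := hx
  have hr1 : (((I.2 - mid I : ℤ)) : ℝ) ≤ ((rad I : ℤ) : ℝ) := by exact_mod_cast le_max_left _ _
  have hr2 : (((mid I - I.1 : ℤ)) : ℝ) ≤ ((rad I : ℤ) : ℝ) := by exact_mod_cast le_max_right _ _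
  push_cast at hr1 hr2
  rw [abs_le]
  constructor <;> linarith

/-! ## The pair data read in `ℝ` -/

section Pair

variable (L : ℕ) [NeZero L] (s1 s2 : ℕ) (G : List (List Iv)) (E : ℕ → ℕ → ℤ)

/-- the slot point as a torus site. [folklore] -/
def ptT (p : ℕ) : Tor L := ((((slotPt L s1 s2 p).1 : ℕ) : ZMod L), (((slotPt L s1 s2 p).2 : ℕ) : ZMod L))

/-- the checker's own interval Green matrix of the pair (`gMat` over the shared tables). [folklore] -/
def GI : List (List Iv) := gMat L (cosTab L) (einvTab L (cosTab L) (gFix L)) s1 s2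

/-- an integer charge map `E` (fixed point; ANY `E` is admissible — the checker uses `eMat`) read in `ℝ`: `E_r = E/D`. [folklore] -/
noncomputable def ER (p q : ℕ) : ℝ := ((E p q : ℤ) : ℝ) / ((D : ℤ) : ℝ)

/-- `X_r = X2/(2D)`. [folklore] -/
noncomputable def XR (p q : ℕ) : ℝ := ((x2Mat G p q : ℤ) : ℝ) / (2 * ((D : ℤ) : ℝ))

/-- the true Green matrix `Re G̃_{g_L}(pt p − pt q)`. [folklore] -/
noncomputable def GR (p q : ℕ) : ℝ := (TwoHoleBS.greenW L (gR L) (ptT L s1 s2 p - ptT L s1 s2 q)).re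

/-- `S_r = E_r + E_rᵀ − E_rᵀ X_r E_r − ½`. [folklore] -/
noncomputable def SR (p q : ℕ) : ℝ :=
  ER E p q + ER E q p
    - (∑ a ∈ range 10, ∑ b ∈ range 10, ER E a p * XR G a b * ER E b q)
    - (if p = q then (1 : ℝ) / 2 else 0)

omit [NeZero L] in
/-- slot coordinates are reduced. [folklore] -/
theorem slotPt_lt (hL : 3 ≤ L) (p : ℕ) : (slotPt L s1 s2 p).1 < L ∧ (slotPt L s1 s2 p).2 < L := by
  have h0 : 0 < L := by omega
  unfold slotPt
  split_ifs <;> simp only [] <;> first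
    | exact ⟨h0, h0⟩ | exact ⟨Nat.mod_lt _ h0, h0⟩ | exact ⟨h0, Nat.mod_lt _ h0⟩ | exact ⟨Nat.mod_lt _ h0, Nat.mod_lt _ h0⟩

omit [NeZero L] in
/-- the difference of two slot points in reduced coordinates. [folklore] -/
theorem ptT_sub (hL : 3 ≤ L) (p q : ℕ) :
    ptT L s1 s2 p - ptT L s1 s2 q
      = (((((slotPt L s1 s2 p).1 + (L - (slotPt L s1 s2 q).1)) % L : ℕ) : ZMod L),
         ((((slotPt L s1 s2 p).2 + (L - (slotPt L s1 s2 q).2)) % L : ℕ) : ZMod L)) := by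
  obtain ⟨hq1, hq2⟩ := slotPt_lt L s1 s2 hL q
  unfold ptT
  ext <;> simp only [Prod.fst_sub, Prod.snd_sub, ZMod.natCast_mod, Nat.cast_add, Nat.cast_sub hq1.le, Nat.cast_sub hq2.le,
    ZMod.natCast_self] <;> ring

omit [NeZero L] in
/-- lookup in the interval Green matrix. [folklore] -/
theorem getM_GI {p q : ℕ} (hp : p < 10) (hq : q < 10) :
    getM (GI L s1 s2) p q = gEntry L (cosTab L) (einvTab L (cosTab L) (gFix L)) s1 s2 p q := by
  unfold getM GI gMat getIv
  rw [getD_map_range _ _ hp, getD_map_range _ _ hq]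

/-- ★ the true Green matrix entry lies in its interval. [folklore] -/
theorem mem_GR (hL : 3 ≤ L) (hpos : epsPos L (cosTab L) (gFix L) = true) {p q : ℕ} (hp : p < 10) (hq : q < 10) :
    mem (GR L s1 s2 p q) (getM (GI L s1 s2) p q) := by
  rw [getM_GI L s1 s2 hp hq]
  unfold GR gEntry
  rw [ptT_sub L s1 s2 hL]
  have h0 : 0 < L := by omega
  exact mem_greenW L hL hpos (Nat.mod_lt _ h0) (Nat.mod_lt _ h0)

/-- the ENCLOSURE HYPOTHESIS on an interval Green matrix `G'` (a predicate of the pair and the matrix): every true entry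
`Re G̃_{g_L}(pt p − pt q)` lies in `G'_pq`. [folklore] -/
def GEncl (G' : List (List Iv)) : Prop := ∀ p q : ℕ, p < 10 → q < 10 → mem (GR L s1 s2 p q) (getM G' p q)

/-- the checker's own Green matrix satisfies the enclosure hypothesis (`3 ≤ L`, `epsPos`). [folklore] -/
theorem gEncl_GI (hL : 3 ≤ L) (hpos : epsPos L (cosTab L) (gFix L) = true) : GEncl L s1 s2 (GI L s1 s2) :=
  fun _ _ hp hq => mem_GR L s1 s2 hL hpos hp hq

/-- ★ `Σ y G y ≤ Σ y X_r y` for any enclosing interval matrix. [folklore] -/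
theorem quad_GR_le_XR (hG : GEncl L s1 s2 G) (y : ℕ → ℝ) :
    (∑ p ∈ range 10, ∑ q ∈ range 10, y p * GR L s1 s2 p q * y q)
      ≤ ∑ p ∈ range 10, ∑ q ∈ range 10, y p * XR G p q * y q := by
  have hD := D_pos
  set Dr : ℝ := ((D : ℤ) : ℝ) with hDr
  have hnear : ∀ p q, p < 10 → q < 10 →
      |GR L s1 s2 p q - ((mid (getM G p q) : ℤ) : ℝ) / Dr| ≤ ((rad (getM G p q) : ℤ) : ℝ) / Dr := by
    intro p q hp hq
    have h := abs_sub_mid_le (hG p q hp hq)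
    rw [le_div_iff₀ hD, ← abs_of_pos hD, ← abs_mul, abs_of_pos hD]
    have e : (GR L s1 s2 p q - ((mid (getM G p q) : ℤ) : ℝ) / Dr) * Dr
        = GR L s1 s2 p q * Dr - ((mid (getM G p q) : ℤ) : ℝ) := by
      field_simp
    rw [e]; exact h
  have h := quad_le_of_near 10 (GR L s1 s2) (fun p q => ((mid (getM G p q) : ℤ) : ℝ) / Dr)
    (fun p q => ((rad (getM G p q) : ℤ) : ℝ) / Dr) y hnear
  refine h.trans (le_of_eq ?_)
  -- the right-hand side is `Σ y X_r y`
  unfold XR x2Mat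
  push_cast
  have ediag : ∀ p ∈ range 10, ∑ q ∈ range 10,
      y p * ((2 * ((mid (getM G p q) : ℤ) : ℝ)
        + (if p = q then ∑ t ∈ range 10, ((((rad (getM G p t)) : ℤ) : ℝ) + (((rad (getM G t p)) : ℤ) : ℝ))
           else 0)) / (2 * Dr)) * y q
      = (∑ q ∈ range 10, y p * (((mid (getM G p q) : ℤ) : ℝ) / Dr) * y q)
        + y p ^ 2 * ∑ q ∈ range 10,
            ((((rad (getM G p q)) : ℤ) : ℝ) / Dr + (((rad (getM G q p)) : ℤ) : ℝ) / Dr) / 2 := by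
    intro p hp
    have split : ∀ q ∈ range 10,
        y p * ((2 * ((mid (getM G p q) : ℤ) : ℝ)
          + (if p = q then ∑ t ∈ range 10, ((((rad (getM G p t)) : ℤ) : ℝ) + (((rad (getM G t p)) : ℤ) : ℝ))
             else 0)) / (2 * Dr)) * y q
        = y p * (((mid (getM G p q) : ℤ) : ℝ) / Dr) * y q
          + (if p = q then y p * y q * (∑ t ∈ range 10,
              ((((rad (getM G p t)) : ℤ) : ℝ) + (((rad (getM G t p)) : ℤ) : ℝ))) / (2 * Dr) else 0) := by
      intro q _
      split_ifs
      · ring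
      · ring
    rw [Finset.sum_congr rfl split, Finset.sum_add_distrib, Finset.sum_ite_eq]
    rw [if_pos hp]
    congr 1
    rw [Finset.mul_sum, Finset.mul_sum, Finset.sum_div]
    refine Finset.sum_congr rfl fun t _ => ?_
    ring
  rw [Finset.sum_congr rfl ediag, Finset.sum_add_distrib]

end Pair

end Hole2

end Summit.HubbardSuperconductivity.HubbardSuperconductivity.Theorems.AnisotropyChord.Transfer.Fibre3
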